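import Summits.BirchSwinnertonDyer.BirchSwinnertonDyer.Theorems.EisensteinPrimesCharGrSelmerCorankGePointwise
import Summits.BirchSwinnertonDyer.BirchSwinnertonDyer.Theorems.EisensteinPrimesXAcLambdaIdentityOfPrimitive
import Summits.BirchSwinnertonDyer.BirchSwinnertonDyer.Theorems.EisensteinPrimesStrictEqUnramifiedDualTransferOfPoitouTateAt
import Summits.BirchSwinnertonDyer.BirchSwinnertonDyer.Theorems.EisensteinPrimesGrDualImprimitiveOfPrimitiveChar
import HarnessLib

/-!
# [ALG-imp] + [PWL-θ] as an EQUALITY at a NON-SPLIT multiplicative Eisenstein datum WITHOUT CGLS Prop. 1.2.5 by name: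
# `λ(𝔛^{Sf}_f) = λ(X_nr(θsub)) + λ(X_nr(θquot)) + Σ_{w∈Sf}(λ𝒫_w(θsub) + λ𝒫_w(θquot))` for the PRIMITIVE UNRAMIFIED character duals, from
# Cor. 1.2.6 ×2, Greenberg 2016 Prop. 2.6.3 (c) TC, Greenberg 2006 4.1/4.2/§5A/3.2, Milne I 4.10 (a) and the PRIMITIVE unramified triples
# (cell `bsd-eis`, width seat `bsd-line-x2-p2` gen 27; crux 4 `BSDpOnCellC` stmt-BirchSwinnertonDyer-19034, line telescope v21 UNCHANGED;
# P4-e of the C2 programme, evidence #59)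

The prop125-DROP twins of x2-p2 g8/g10/g18's chain `CharGrSelmerLambdaRelaxation.charLambdaRelaxation_of_facts` →
`GrSelmerQuotientCorankLe.charLambdaRelaxation_eq_of_not_split_of_facts` → `…lambdaInvariant_xAc_eq_add_add_sum_of_not_split_ofPoitouTateAt` →
`StrictEqUnramifiedCentral.lambdaInvariant_xAc_eq_add_add_sum_unr_of_not_split_ofPoitouTateAt` (the algebraic identity the NON-split imprimitive
count consumes): the two ∀θ named hypotheses `(hprop125 : prop125_characterGrSelmerDual_torsion_muZero_dim) (hge : prop125_characterGrSelmerDual_corank_ge)`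
(and `hfact : prop14_…`, `hred`) are REPLACED by the PRIMITIVE unramified triples `hprimsub hprimquot` of the residual pair — the (f.g., torsion,
`μ = 0`) triple at `Sf` comes from this seat's `GrDualImprimitiveOfPrimitiveChar` (p789816), the corank clause POINTWISE from
`CharGrSelmerCorankGePointwise.sum_charLocalLambda_le_zpCorank_of_primitive_ofSurC` (P4-d), the λ-identity from
`XAcLambdaIdentityOfPrimitive` (P4-c); everything else (g8's strict λ-shift, the unconditional `≤ Σ λ𝒫_w` of `GrSelmerQuotientCorankLe`, the
strict = unramified bridge at a non-split datum, Brink) is reused BY NAME.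

HONEST FRAMING: theorems only (no definition, no named fact, no `sorry`, no instance); CONDITIONAL on CGLS Cor. 1.2.6 ×2 (`hlift hlocal`), Greenberg
2016 Prop. 2.6.3 (c) at TC fields (`h263`, fed at the head from Milne I 4.10 (a)), Greenberg 2006 Props. 4.1 / 4.2 / §5 A / 3.2 and Milne I 4.10 (a)
(`h41 h42 h5A h32 hX`, tree theorems at the head) and the primitive triples; originals untouched; closes no stub, moves no count (27 names by name of
record); BSD is proved for no curve.
-/

set_option autoImplicit false
set_option linter.dupNamespace false -- the summit namespace `…BirchSwinnertonDyer.BirchSwinnertonDyer.Theorems` (Sub = Summit, D-0017) trips it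

noncomputable section

open scoped Classical AddSubgroup
open NumberField IsDedekindDomain Field WeierstrassCurve
open Literature.NumberTheory.EllipticCurves Literature.NumberTheory.EllipticCurves.GreenbergSelmer
  Literature.NumberTheory.EllipticCurves.GreenbergVatsal2000 Literature.NumberTheory.GaloisRepresentations
  Literature.NumberTheory.EllipticCurves.KellerYin2024 Literature.NumberTheory.EllipticCurves.IwasawaAlgebra
  Literature.NumberTheory.EllipticCurves.Castella2018.AcSelmer Literature.NumberTheory.EllipticCurves.Rank1Residual
  Literature.NumberTheory.EllipticCurves.CastellaGrossiLeeSkinner2022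
  Literature.NumberTheory.IwasawaTheory Literature.NumberTheory.IwasawaTheory.Greenberg2016
  Literature.NumberTheory.IwasawaTheory.Greenberg2006
  Summit.BirchSwinnertonDyer.BirchSwinnertonDyer.Theorems

namespace Summit.BirchSwinnertonDyer.BirchSwinnertonDyer.Theorems.CharLambdaIdentityOfPrimitive

variable {p : ℕ} [hp : Fact p.Prime]

/-! ## §1 Character level: the `S`-relaxation of the strict duals from the primitive triple and the pointwise corank clause -/

/-- **[prop125-DROP twin of `CharGrSelmerLambdaRelaxation.charLambdaRelaxation_of_facts`: `(hprop125)` ↦ the primitive unramified triple `hprim`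
of `θ` (via `grDual_moduleFinite_isTorsion_muZero_of_unrDual_primitive`), `(hge)` ↦ the POINTWISE corank inequality `hc` for `θ`; the binders
`hsplit hvbar hunr hneω` leave (they only fed the two named facts).]** For a Teichmüller character `θ` of the imaginary quadratic `K` (`p` odd, `κ`
anticyclotomic with generator `γ`, any `v̄`, `S` prime to `p` over split rational primes, `θ|_{G_v̄} ≠ 𝟙`) and ALL strict dual data `DS` (at `S`),
`D0` (at `∅`): `D0.X` is f.g. torsion with `μ = 0`, **`λ(DS.X) = λ(D0.X) + corank_{ℤ_p}(H¹_{𝓕_Gr^S}/H¹_{𝓕_Gr})`**, and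
`λ(D0.X) + Σ_{w∈S} λ𝒫_w(θ) ≤ λ(DS.X)`. [cite: CastellaGrossiLeeSkinner2022, §1.2 Prop. 1.2.5 and proof (eq:sur2) (arXiv:2008.02571 Prop. 14)]
[cite: GreenbergVatsal2000, §2 Cor. (2.3) (pp. 20–21)] [cite: KellerYin2024, Prop. 1.2.5 (arXiv:2402.12781v2 TeX L780–800)] -/
theorem charLambdaRelaxation_of_primitive
    (K : Type) [Field K] [NumberField K] (hK : IsImaginaryQuadratic K) (hp2 : p ≠ 2)
    (κ : ZpExtension K p) (hκ : κ.IsAnticyclotomic) (γ : absoluteGaloisGroup K) (hγ : κ.IsTopGenerator γ)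
    (vbar : HeightOneSpectrum (𝓞 K))
    (θ : FramedGaloisRep K (padicCoeffIntegers (∅ : Set (PadicAlgCl p))) 1)
    (hθ : ∀ σ : absoluteGaloisGroup K, θ σ ^ (p - 1) = 1)
    (S : Finset (HeightOneSpectrum (𝓞 K)))
    (hSmem : ∀ v ∈ S, ((p : ℕ) : 𝓞 K) ∉ v.asIdeal ∧ ((v.asIdeal.under ℤ).primesOver (𝓞 K)).ncard = 2)
    (hne1 : ¬ ∀ g ∈ decomp vbar, ∀ m : charModule (∅ : Set (PadicAlgCl p)) θ, p • m = 0 → g • m = m)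
    (hprim : ∀ D : DatumDualData κ γ (charModule (∅ : Set (PadicAlgCl p)) θ)
      (Castella2018.AcSelmer.bdpData (charModule (∅ : Set (PadicAlgCl p)) θ) p vbar) (∅ : Set (HeightOneSpectrum (𝓞 K))),
      Module.Finite (IwasawaAlgebra p) D.X ∧ Module.IsTorsion (IwasawaAlgebra p) D.X ∧ muInvariant p D.X = 0)
    (hc : ∑ w ∈ S, charLocalLambda (∅ : Set (PadicAlgCl p)) κ θ w ≤
      zpCorank (↥(grSelmer κ (charModule (∅ : Set (PadicAlgCl p)) θ) vbar (↑S : Set (HeightOneSpectrum (𝓞 K)))) ⧸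
        (grSelmer κ (charModule (∅ : Set (PadicAlgCl p)) θ) vbar (∅ : Set (HeightOneSpectrum (𝓞 K)))).addSubgroupOf
          (grSelmer κ (charModule (∅ : Set (PadicAlgCl p)) θ) vbar (↑S : Set (HeightOneSpectrum (𝓞 K))))) p)
    (DS : GrDualData κ (charModule (∅ : Set (PadicAlgCl p)) θ) vbar (↑S : Set (HeightOneSpectrum (𝓞 K))) γ)
    (D0 : GrDualData κ (charModule (∅ : Set (PadicAlgCl p)) θ) vbar (∅ : Set (HeightOneSpectrum (𝓞 K))) γ) :
    Module.Finite (IwasawaAlgebra p) D0.X ∧ Module.IsTorsion (IwasawaAlgebra p) D0.X ∧ muInvariant p D0.X = 0 ∧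
      lambdaInvariant p DS.X = lambdaInvariant p D0.X +
        zpCorank (↥(grSelmer κ (charModule (∅ : Set (PadicAlgCl p)) θ) vbar (↑S : Set (HeightOneSpectrum (𝓞 K)))) ⧸
          (grSelmer κ (charModule (∅ : Set (PadicAlgCl p)) θ) vbar (∅ : Set (HeightOneSpectrum (𝓞 K)))).addSubgroupOf
            (grSelmer κ (charModule (∅ : Set (PadicAlgCl p)) θ) vbar (↑S : Set (HeightOneSpectrum (𝓞 K))))) p ∧
      lambdaInvariant p D0.X + ∑ w ∈ S, charLocalLambda (∅ : Set (PadicAlgCl p)) κ θ w ≤ lambdaInvariant p DS.X := by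
  obtain ⟨hfg, hT, hμ⟩ :=
    GrDualImprimitiveOfPrimitiveChar.grDual_moduleFinite_isTorsion_muZero_of_unrDual_primitive hK hp2 κ hκ hγ vbar θ hθ hne1 S hSmem
      hprim DS
  haveI := hfg
  obtain ⟨hfg0, hT0, hμ0, -, hlam⟩ :=
    GrSelmerImprimitiveLambdaShift.lambdaInvariant_eq_add_zpCorank_of_muInvariant_eq_zero κ vbar
      (exists_pow_smul_cofree_eq_zero (∅ : Set (PadicAlgCl p)) θ) (isOpen_stabilizer_cofree (∅ : Set (PadicAlgCl p)) θ) hγ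
      (Set.empty_subset (↑S : Set (HeightOneSpectrum (𝓞 K)))) DS hT hμ D0
  -- restate the λ-shift with the quotient spelled through `charModule` (an `abbrev` of `Cofree`), so that `omega` sees one atom
  have hlam' : lambdaInvariant p DS.X = lambdaInvariant p D0.X +
      zpCorank (↥(grSelmer κ (charModule (∅ : Set (PadicAlgCl p)) θ) vbar (↑S : Set (HeightOneSpectrum (𝓞 K)))) ⧸
        (grSelmer κ (charModule (∅ : Set (PadicAlgCl p)) θ) vbar (∅ : Set (HeightOneSpectrum (𝓞 K)))).addSubgroupOf
          (grSelmer κ (charModule (∅ : Set (PadicAlgCl p)) θ) vbar (↑S : Set (HeightOneSpectrum (𝓞 K))))) p := hlam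
  exact ⟨hfg0, hT0, hμ0, hlam', by omega⟩

/-! ## §2 At a NON-SPLIT multiplicative Eisenstein datum: CGLS Prop. 1.2.5's λ-clause for either residual character -/

/-- **[prop125-DROP twin of `GrSelmerQuotientCorankLe.charLambdaRelaxation_eq_of_not_split_of_facts`.]** **CGLS Prop. 1.2.5's λ-clause
`λ(𝔛_θ^S) = λ(𝔛_θ) + Σ_{w∈S} λ(𝒫_w(θ))` at a NON-SPLIT multiplicative Eisenstein datum, for either residual character `θ ∈ {θsub, θquot}` and ALL
strict dual data `DS` (at `Sf`), `D0` (at `∅`)**, GRANTED Greenberg 2016 Prop. 2.6.3 (c) at TC fields, Greenberg 2006 Props. 4.1 / 4.2 / §5 A BY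
NAME and the PRIMITIVE unramified triple `hprim` of `θ`: §1 (λ-shift = corank) + the POINTWISE corank clause (P4-d) + the unconditional
`corank ≤ Σ λ𝒫_w` (`GrSelmerQuotientCorankLe.zpCorank_grSelmer_quotient_le_sum_charLocalLambda`; Brink at the Heegner places). Datum: `W/ℚ`
globally minimal, `2 < p`, `p ‖ N` NON-split, `K` imaginary quadratic Heegner for `N_E`, `(p)` split, `v̄ ∋ p`, `κ` anticyclotomic with generator
`γ`, `Sf` = places over `N_E` off `p`; character binders from g8's `charHypotheses_of_not_split`.
[cite: CastellaGrossiLeeSkinner2022, §1.2 Prop. 1.2.5 ("λ(𝔛_θ^S) = λ(𝔛_θ) + Σ_{w∈Σ, w∤p} λ(𝒫_w(θ))"; arXiv:2008.02571 Prop. 14)]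
[cite: KellerYin2024, Prop. 1.2.5, Lemma 5.1.1 (arXiv:2402.12781v2)] [cite: Brink2007, Thm. 2] [cite: Greenberg2016Selmer, Prop. 2.6.3 (c)] -/
theorem charLambdaRelaxation_eq_of_not_split_of_primitive
    (h263 : prop263_sur_of_crk_caseC_tc) (h41 : prop41_globalEulerPoincareCorank) (h42 : prop42_localEulerPoincareCorank)
    (h5A : sec5A_localH2_subsingleton_of_LOC1)
    (W : WeierstrassCurve ℚ) [W.IsElliptic] [W.IsGloballyMinimal]
    (K : Type) [Field K] [NumberField K] (vbar : HeightOneSpectrum (𝓞 K))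
    (κ : ZpExtension K p) (γ : absoluteGaloisGroup K) [hγ : Fact (κ.IsTopGenerator γ)]
    (Sf : Finset (HeightOneSpectrum (𝓞 K)))
    (hp2 : 2 < p) (hmult : Mult W p) (hns : ¬ W.HasSplitMultiplicativeReductionAtPrime p)
    (hK : IsImaginaryQuadratic K) (hH : SatisfiesHeegnerHypothesis (W.conductorNorm ℤ) K)
    (hsplit : ((Ideal.span {(p : ℤ)}).primesOver (𝓞 K)).ncard = 2)
    (hvbar : ((p : ℕ) : 𝓞 K) ∈ vbar.asIdeal) (hκ : κ.IsAnticyclotomic)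
    (hSf : ∀ w : HeightOneSpectrum (𝓞 K), w ∈ Sf ↔
      (((W.conductorNorm ℤ : ℤ) : 𝓞 K) ∈ w.asIdeal ∧ ((p : ℕ) : 𝓞 K) ∉ w.asIdeal))
    (θsub θquot : FramedGaloisRep K (padicCoeffIntegers (∅ : Set (PadicAlgCl p))) 1)
    (hpair : IsResidualPairOver (W.baseChange K) p θsub θquot)
    (θ : FramedGaloisRep K (padicCoeffIntegers (∅ : Set (PadicAlgCl p))) 1) (hθ : θ = θsub ∨ θ = θquot)
    (hprim : ∀ D : DatumDualData κ γ (charModule (∅ : Set (PadicAlgCl p)) θ)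
      (Castella2018.AcSelmer.bdpData (charModule (∅ : Set (PadicAlgCl p)) θ) p vbar) (∅ : Set (HeightOneSpectrum (𝓞 K))),
      Module.Finite (IwasawaAlgebra p) D.X ∧ Module.IsTorsion (IwasawaAlgebra p) D.X ∧ muInvariant p D.X = 0)
    (DS : GrDualData κ (charModule (∅ : Set (PadicAlgCl p)) θ) vbar (↑Sf : Set (HeightOneSpectrum (𝓞 K))) γ)
    (D0 : GrDualData κ (charModule (∅ : Set (PadicAlgCl p)) θ) vbar (∅ : Set (HeightOneSpectrum (𝓞 K))) γ) :
    lambdaInvariant p DS.X = lambdaInvariant p D0.X + ∑ w ∈ Sf, charLocalLambda (∅ : Set (PadicAlgCl p)) κ θ w := by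
  have hp2' : p ≠ 2 := by omega
  obtain ⟨hSmem, hchar⟩ := CharGrSelmerLambdaRelaxation.charHypotheses_of_not_split W K vbar κ Sf hp2 hmult hns hK hH hsplit hvbar
    hSf θsub θquot hpair
  obtain ⟨hθT, hunr, hne1, -⟩ := hchar θ hθ
  have hc := CharGrSelmerCorankGePointwise.sum_charLocalLambda_le_zpCorank_of_primitive_ofSurC h263 h41 h42 h5A hK hp2' hsplit κ hκ
    hγ.out vbar hvbar θ hθT Sf hSmem hunr hne1 hprim
  obtain ⟨-, -, -, hlam, -⟩ := charLambdaRelaxation_of_primitive K hK hp2' κ hκ γ hγ.out vbar θ hθT Sf hSmem hne1 hprim hc DS D0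
  have hD : ∀ w ∈ Sf, ∃ δ ∈ decomp (K := K) w, κ δ ≠ 1 := fun w hw ↦
    UnrSelmerQuotientTorsionFiniteChar.exists_mem_decomp_apply_ne_one_of_heegner hK hp2 hH κ hκ w ((hSf w).mp hw).1 ((hSf w).mp hw).2
  have hle := GrSelmerQuotientCorankLe.zpCorank_grSelmer_quotient_le_sum_charLocalLambda κ hγ.out vbar θ hθT Sf
    (fun w hw ↦ (hSmem w hw).1) hD
  rw [hlam, le_antisymm hle hc]

/-! ## §3 [ALG-imp] + [PWL-θ] as an EQUALITY, strict and unramified primitive duals -/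

/-- **[prop125/prop14-DROP twin of `GrSelmerQuotientCorankLe.lambdaInvariant_xAc_eq_add_add_sum_of_not_split_ofPoitouTateAt`.]**
**`λ(𝔛^{Sf}_f) = λ(𝔛_{θsub}) + λ(𝔛_{θquot}) + Σ_{w∈Sf} (λ𝒫_w(θsub) + λ𝒫_w(θquot))`** at a NON-SPLIT multiplicative Eisenstein datum, for ALL strict
dual data `D0sub`, `D0quot` of the PRIMITIVE character Selmer groups — GRANTED CGLS Cor. 1.2.6 ×2, Greenberg 2016 Prop. 2.6.3 (c) at TC fields,
Greenberg 2006 Props. 4.1 / 4.2 / §5 A / 3.2, Milne I 4.10 (a) BY NAME and the PRIMITIVE unramified triples of the two characters: P4-c's λ-identity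
`λ(𝔛^{Sf}_f) = λ(Dsub) + λ(Dquot)` at `Sf` + §2 twice. CGLS (eq:lambda-imp) ∘ Prop. 1.2.5; Keller–Yin Thm. 1.4.1 ∘ Prop. 1.2.5.
[cite: CastellaGrossiLeeSkinner2022, §1.2 Prop. 1.2.5, §1.4, proof of Thm. 1.5.1 (eq:lambda-imp) (arXiv:2008.02571)] [cite: KellerYin2024, Thm. 1.4.1, Prop. 1.2.5 (arXiv:2402.12781v2)]
[cite: Greenberg2016Selmer, Prop. 2.6.3 (c), Prop. 4.1.1 (c)] [cite: Greenberg2006, Props. 3.2, 4.1, 4.2, §5 A] [cite: MilneADT2006, I Thm. 4.10 (a)] -/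
theorem lambdaInvariant_xAc_eq_add_add_sum_of_not_split_of_primitive_ofPoitouTateAt
    (h263 : prop263_sur_of_crk_caseC_tc) (h5A : sec5A_localH2_subsingleton_of_LOC1)
    (hlift : cor126_residualCharacter_globalLift) (hlocal : cor126_residualCharacter_localSurjective)
    (hX : ∀ (L : Type) [Field L] [NumberField L] [IsTotallyComplex L] (S : Set (HeightOneSpectrum (𝓞 L))),
      S.Finite → Literature.NumberTheory.GaloisCohomology.poitouTate_shaRestricted_tateDual_natural_at L S)
    (h41 : prop41_globalEulerPoincareCorank) (h42 : prop42_localEulerPoincareCorank) (h32 : prop32_cohomology_isCofinitelyGenerated)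
    (W : WeierstrassCurve ℚ) [W.IsElliptic] [W.IsGloballyMinimal]
    (K : Type) [Field K] [NumberField K] {v : HeightOneSpectrum (𝓞 K)} (vbar : HeightOneSpectrum (𝓞 K))
    (κ : ZpExtension K p) (γ : absoluteGaloisGroup K) [Fact (κ.IsTopGenerator γ)]
    (Sf : Finset (HeightOneSpectrum (𝓞 K)))
    (hp2 : 2 < p) (hmult : Mult W p) (hns : ¬ W.HasSplitMultiplicativeReductionAtPrime p)
    (hK : IsImaginaryQuadratic K) (hH : SatisfiesHeegnerHypothesis (W.conductorNorm ℤ) K)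
    (hsplit : ((Ideal.span {(p : ℤ)}).primesOver (𝓞 K)).ncard = 2)
    (hv : ((p : ℕ) : 𝓞 K) ∈ v.asIdeal) (hvbar : ((p : ℕ) : 𝓞 K) ∈ vbar.asIdeal) (hne : vbar ≠ v) (hκ : κ.IsAnticyclotomic)
    (hSf : ∀ w : HeightOneSpectrum (𝓞 K), w ∈ Sf ↔
      (((W.conductorNorm ℤ : ℤ) : 𝓞 K) ∈ w.asIdeal ∧ ((p : ℕ) : 𝓞 K) ∉ w.asIdeal))
    (θsub θquot : FramedGaloisRep K (padicCoeffIntegers (∅ : Set (PadicAlgCl p))) 1)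
    (hpair : IsResidualPairOver (W.baseChange K) p θsub θquot)
    (hprimsub : ∀ D : DatumDualData κ γ (charModule (∅ : Set (PadicAlgCl p)) θsub)
      (Castella2018.AcSelmer.bdpData (charModule (∅ : Set (PadicAlgCl p)) θsub) p vbar) (∅ : Set (HeightOneSpectrum (𝓞 K))),
      Module.Finite (IwasawaAlgebra p) D.X ∧ Module.IsTorsion (IwasawaAlgebra p) D.X ∧ muInvariant p D.X = 0)
    (hprimquot : ∀ D : DatumDualData κ γ (charModule (∅ : Set (PadicAlgCl p)) θquot)
      (Castella2018.AcSelmer.bdpData (charModule (∅ : Set (PadicAlgCl p)) θquot) p vbar) (∅ : Set (HeightOneSpectrum (𝓞 K))),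
      Module.Finite (IwasawaAlgebra p) D.X ∧ Module.IsTorsion (IwasawaAlgebra p) D.X ∧ muInvariant p D.X = 0)
    (D0sub : GrDualData κ (charModule (∅ : Set (PadicAlgCl p)) θsub) vbar (∅ : Set (HeightOneSpectrum (𝓞 K))) γ)
    (D0quot : GrDualData κ (charModule (∅ : Set (PadicAlgCl p)) θquot) vbar (∅ : Set (HeightOneSpectrum (𝓞 K))) γ) :
    lambdaInvariant p (XAc (W.baseChange K) p κ vbar (↑Sf : Set (HeightOneSpectrum (𝓞 K))) γ) =
      lambdaInvariant p D0sub.X + lambdaInvariant p D0quot.X +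
        ∑ w ∈ Sf, (charLocalLambda (∅ : Set (PadicAlgCl p)) κ θsub w + charLocalLambda (∅ : Set (PadicAlgCl p)) κ θquot w) := by
  obtain ⟨Dsub⟩ := nonempty_grDualData_char (∅ : Set (PadicAlgCl p)) θsub κ vbar (↑Sf : Set (HeightOneSpectrum (𝓞 K)))
    (Fact.out : κ.IsTopGenerator γ)
  obtain ⟨Dquot⟩ := nonempty_grDualData_char (∅ : Set (PadicAlgCl p)) θquot κ vbar (↑Sf : Set (HeightOneSpectrum (𝓞 K)))
    (Fact.out : κ.IsTopGenerator γ)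
  have halg := XAcLambdaIdentityOfPrimitive.lambdaInvariant_xAc_eq_add_of_not_split_of_primitive_ofPoitouTateAt hlift hlocal hX h41 h42 h32
    W K vbar κ γ Sf hp2 hmult hns hK hH hsplit hv hvbar hne hκ hSf θsub θquot hpair hprimsub hprimquot Dsub Dquot
  have hsub := charLambdaRelaxation_eq_of_not_split_of_primitive h263 h41 h42 h5A W K vbar κ γ Sf hp2 hmult hns hK hH hsplit hvbar hκ hSf
    θsub θquot hpair θsub (Or.inl rfl) hprimsub Dsub D0sub
  have hquot := charLambdaRelaxation_eq_of_not_split_of_primitive h263 h41 h42 h5A W K vbar κ γ Sf hp2 hmult hns hK hH hsplit hvbar hκ hSf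
    θsub θquot hpair θquot (Or.inr rfl) hprimquot Dquot D0quot
  rw [halg, hsub, hquot, Finset.sum_add_distrib]
  ring

/-- **[prop125/prop14-DROP twin of `StrictEqUnramifiedCentral.lambdaInvariant_xAc_eq_add_add_sum_unr_of_not_split_ofPoitouTateAt`.]**
**`λ(𝔛^{Sf}_f) = λ(X_nr(θsub)) + λ(X_nr(θquot)) + Σ_{w∈Sf} (λ𝒫_w(θsub) + λ𝒫_w(θquot))` for the PRIMITIVE UNRAMIFIED duals** (`DatumDualData … ∅`,
the currency in which the tree's character main-conjecture engines conclude), at a NON-SPLIT multiplicative Eisenstein datum: §3 for every strict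
pair, transported along g8's unconditional bridge `grSelmer = unrSelmer` at a non-split datum (`grSelmer_eq_unrSelmer_of_not_split`,
`prop_datumDualData_of_forall_grDualData`). [cite: KellerYin2024, Thm. 1.4.1 (arXiv:2402.12781v2)] [cite: GreenbergVatsal2000, §2 pp. 15–21]
[cite: CastellaGrossiLeeSkinner2022, proof of Thm. 1.2.2, Prop. 1.2.5] -/
theorem lambdaInvariant_xAc_eq_add_add_sum_unr_of_not_split_of_primitive_ofPoitouTateAt
    (h263 : prop263_sur_of_crk_caseC_tc) (h5A : sec5A_localH2_subsingleton_of_LOC1)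
    (hlift : cor126_residualCharacter_globalLift) (hlocal : cor126_residualCharacter_localSurjective)
    (hX : ∀ (L : Type) [Field L] [NumberField L] [IsTotallyComplex L] (S : Set (HeightOneSpectrum (𝓞 L))),
      S.Finite → Literature.NumberTheory.GaloisCohomology.poitouTate_shaRestricted_tateDual_natural_at L S)
    (h41 : prop41_globalEulerPoincareCorank) (h42 : prop42_localEulerPoincareCorank) (h32 : prop32_cohomology_isCofinitelyGenerated)
    (W : WeierstrassCurve ℚ) [W.IsElliptic] [W.IsGloballyMinimal]
    (K : Type) [Field K] [NumberField K] {v : HeightOneSpectrum (𝓞 K)} (vbar : HeightOneSpectrum (𝓞 K))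
    (κ : ZpExtension K p) (γ : absoluteGaloisGroup K) [Fact (κ.IsTopGenerator γ)]
    (Sf : Finset (HeightOneSpectrum (𝓞 K)))
    (hp2 : 2 < p) (hmult : Mult W p) (hns : ¬ W.HasSplitMultiplicativeReductionAtPrime p)
    (hK : IsImaginaryQuadratic K) (hH : SatisfiesHeegnerHypothesis (W.conductorNorm ℤ) K)
    (hsplit : ((Ideal.span {(p : ℤ)}).primesOver (𝓞 K)).ncard = 2)
    (hv : ((p : ℕ) : 𝓞 K) ∈ v.asIdeal) (hvbar : ((p : ℕ) : 𝓞 K) ∈ vbar.asIdeal) (hne : vbar ≠ v) (hκ : κ.IsAnticyclotomic)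
    (hSf : ∀ w : HeightOneSpectrum (𝓞 K), w ∈ Sf ↔
      (((W.conductorNorm ℤ : ℤ) : 𝓞 K) ∈ w.asIdeal ∧ ((p : ℕ) : 𝓞 K) ∉ w.asIdeal))
    (θsub θquot : FramedGaloisRep K (padicCoeffIntegers (∅ : Set (PadicAlgCl p))) 1)
    (hpair : IsResidualPairOver (W.baseChange K) p θsub θquot)
    (hprimsub : ∀ D : DatumDualData κ γ (charModule (∅ : Set (PadicAlgCl p)) θsub)
      (Castella2018.AcSelmer.bdpData (charModule (∅ : Set (PadicAlgCl p)) θsub) p vbar) (∅ : Set (HeightOneSpectrum (𝓞 K))),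
      Module.Finite (IwasawaAlgebra p) D.X ∧ Module.IsTorsion (IwasawaAlgebra p) D.X ∧ muInvariant p D.X = 0)
    (hprimquot : ∀ D : DatumDualData κ γ (charModule (∅ : Set (PadicAlgCl p)) θquot)
      (Castella2018.AcSelmer.bdpData (charModule (∅ : Set (PadicAlgCl p)) θquot) p vbar) (∅ : Set (HeightOneSpectrum (𝓞 K))),
      Module.Finite (IwasawaAlgebra p) D.X ∧ Module.IsTorsion (IwasawaAlgebra p) D.X ∧ muInvariant p D.X = 0)
    (D0sub : DatumDualData κ γ (charModule (∅ : Set (PadicAlgCl p)) θsub)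
      (Castella2018.AcSelmer.bdpData (charModule (∅ : Set (PadicAlgCl p)) θsub) p vbar) (∅ : Set (HeightOneSpectrum (𝓞 K))))
    (D0quot : DatumDualData κ γ (charModule (∅ : Set (PadicAlgCl p)) θquot)
      (Castella2018.AcSelmer.bdpData (charModule (∅ : Set (PadicAlgCl p)) θquot) p vbar) (∅ : Set (HeightOneSpectrum (𝓞 K)))) :
    lambdaInvariant p (XAc (W.baseChange K) p κ vbar (↑Sf : Set (HeightOneSpectrum (𝓞 K))) γ) =
      lambdaInvariant p D0sub.X + lambdaInvariant p D0quot.X +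
        ∑ w ∈ Sf, (charLocalLambda (∅ : Set (PadicAlgCl p)) κ θsub w + charLocalLambda (∅ : Set (PadicAlgCl p)) κ θquot w) := by
  have hsub := StrictEqUnramifiedCentral.grSelmer_eq_unrSelmer_of_not_split κ vbar (∅ : Set (HeightOneSpectrum (𝓞 K))) θsub W Sf hp2
    hmult hns hK hH hsplit hvbar hSf θsub θquot hpair (Or.inl rfl)
  have hquot := StrictEqUnramifiedCentral.grSelmer_eq_unrSelmer_of_not_split κ vbar (∅ : Set (HeightOneSpectrum (𝓞 K))) θquot W Sf hp2
    hmult hns hK hH hsplit hvbar hSf θsub θquot hpair (Or.inr rfl)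
  have hG : ∀ (Gs : GrDualData κ (charModule (∅ : Set (PadicAlgCl p)) θsub) vbar (∅ : Set (HeightOneSpectrum (𝓞 K))) γ)
      (Gq : GrDualData κ (charModule (∅ : Set (PadicAlgCl p)) θquot) vbar (∅ : Set (HeightOneSpectrum (𝓞 K))) γ),
      lambdaInvariant p (XAc (W.baseChange K) p κ vbar (↑Sf : Set (HeightOneSpectrum (𝓞 K))) γ) =
        lambdaInvariant p Gs.X + lambdaInvariant p Gq.X +
          ∑ w ∈ Sf, (charLocalLambda (∅ : Set (PadicAlgCl p)) κ θsub w + charLocalLambda (∅ : Set (PadicAlgCl p)) κ θquot w) :=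
    fun Gs Gq ↦ lambdaInvariant_xAc_eq_add_add_sum_of_not_split_of_primitive_ofPoitouTateAt h263 h5A hlift hlocal hX h41 h42 h32 W K vbar
      κ γ Sf hp2 hmult hns hK hH hsplit hv hvbar hne hκ hSf θsub θquot hpair hprimsub hprimquot Gs Gq
  have h1 : ∀ Gq : GrDualData κ (charModule (∅ : Set (PadicAlgCl p)) θquot) vbar (∅ : Set (HeightOneSpectrum (𝓞 K))) γ,
      lambdaInvariant p (XAc (W.baseChange K) p κ vbar (↑Sf : Set (HeightOneSpectrum (𝓞 K))) γ) =
        lambdaInvariant p D0sub.X + lambdaInvariant p Gq.X +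
          ∑ w ∈ Sf, (charLocalLambda (∅ : Set (PadicAlgCl p)) κ θsub w + charLocalLambda (∅ : Set (PadicAlgCl p)) κ θquot w) :=
    fun Gq ↦ StrictEqUnramifiedCentral.prop_datumDualData_of_forall_grDualData κ vbar ∅ hsub
      (fun (X : Type) [AddCommGroup X] [Module (IwasawaAlgebra p) X] ↦
        lambdaInvariant p (XAc (W.baseChange K) p κ vbar (↑Sf : Set (HeightOneSpectrum (𝓞 K))) γ) =
        lambdaInvariant p X + lambdaInvariant p Gq.X +
          ∑ w ∈ Sf, (charLocalLambda (∅ : Set (PadicAlgCl p)) κ θsub w + charLocalLambda (∅ : Set (PadicAlgCl p)) κ θquot w))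
      (fun Gs ↦ hG Gs Gq) D0sub
  exact StrictEqUnramifiedCentral.prop_datumDualData_of_forall_grDualData κ vbar ∅ hquot
    (fun (Y : Type) [AddCommGroup Y] [Module (IwasawaAlgebra p) Y] ↦
      lambdaInvariant p (XAc (W.baseChange K) p κ vbar (↑Sf : Set (HeightOneSpectrum (𝓞 K))) γ) =
      lambdaInvariant p D0sub.X + lambdaInvariant p Y +
        ∑ w ∈ Sf, (charLocalLambda (∅ : Set (PadicAlgCl p)) κ θsub w + charLocalLambda (∅ : Set (PadicAlgCl p)) κ θquot w))
    h1 D0quot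

end Summit.BirchSwinnertonDyer.BirchSwinnertonDyer.Theorems.CharLambdaIdentityOfPrimitive

end
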